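import Summits.ABC.IUTFork.Joshi.GeometricCase1
import Mathlib.Analysis.Complex.UpperHalfPlane.Topology
import Mathlib.Analysis.Complex.CoveringMap
import Mathlib.Analysis.SpecialFunctions.Complex.Log
import HarnessLib

/-!
# [J-III] §12.3, (12.3.1): a MODEL of the universal cover `S̃L₂(ℝ)` — T-35's interface `CoverSL2R` is inhabited

Block E of the abc-iut cell (rung LADDER-ABC:A2.E), seat abc-iut-E-t53 (batch 3; prover item «MODEL OF (12.3.1)», offered on
STATUS 2026-08-26 08:00Z after the co-typer slot E-t53 ↔ E-t35 turned out to be already typed by E-t35). PROOF/MODEL file over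
`Joshi/GeometricCase1.lean` (E-t35, p431104): no claim-`Prop`, no `Prop` fact, no instance, no `sorry`; standard axioms.

SOURCE. K. Joshi, *Construction of Arithmetic Teichmüller Spaces III*, arXiv:2401.13508**v4** (unrefereed; bib `Joshi2024ATS3`),
§12.3 "The universal cover of `SL₂(ℝ)` and its properties", PDF p.146 l.26–32 (render `HOME/lit/renders/Joshi-arxiv-2401.13508/
p0146.txt`): «Let `S̃L₂(ℝ)` be the universal cover of `SL₂(ℝ)`. Then `S̃L₂(ℝ)` is described as a central extension ([Zhang, 2001,
Lemma 3.5]) (12.3.1) `1 → ⟨z²⟩ → S̃L₂(ℝ) → SL₂(ℝ) → 1` where `z ∈ S̃L₂(ℝ)` is a certain element, which generates the center of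
`S̃L₂(ℝ)` and which is described explicitly in [Zhang, 2001] and so I will not recall that description here.» E-t35 typed (12.3.1)
as the INTERFACE structure `ATS3.Geo.CoverSL2R Y` (fields `proj`, `proj_surjective`, `z`, `center_eq`, `ker_eq`,
`not_isOfFinOrder_z`) and recorded «Mathlib has no universal covering group»; E-t36's `ATS3.GeoLocus.HeightDatum` (p430006,
§§12.9–12.18, Thm. 12.18.1 = the geometric Cor. 3.12 analogue, E-cx's X-04 candidate) carries the same group-theoretic fields and
records «NOT here: a model of `S̃L₂(ℝ)`». THIS FILE SUPPLIES THE MODEL, so both carriers are non-vacuous in the kernel.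

THE MODEL (classical automorphy-factor description of the universal cover; cf. the "`log j(g, τ)`" cocycle picture of `S̃L₂(ℝ)`):
`Cover := {(g, T) ∈ SL₂(ℝ) × Perm(ℍ × ℂ) | ∃ φ : ℍ → ℂ continuous, exp ∘ φ = j(g, ·), T = T_{g,φ}}`, where
`j(g, τ) = cτ + d` is the automorphy factor and `T_{g,φ}(τ, w) = (g•τ, w + φ(τ))`; the group law of the ambient product gives
`(g, φ)·(h, ψ) = (gh, φ ∘ (h•·) + ψ)` (the cocycle `j(gh, τ) = j(g, h•τ)·j(h, τ)` makes this closed), so NO new instance is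
declared (`Cover` is a `Subgroup`, its group structure is Mathlib's). PROVED (elementary; [folklore]):
* `proj_surjective` — every `j(g, ·)` has a continuous logarithm on `ℍ` (`Complex.log` on the upper half-plane);
* uniqueness of logarithms up to `2πiℤ` on the (contractible, hence preconnected) space `ℍ` — Mathlib's
  `Complex.isCoveringMap_exp` + `IsCoveringMap.const_of_comp`;
* `z := (−1, T_{−1, iπ})`; `z ^ n = ((−1)^n, T_{(−1)^n, inπ})`; the fibre of `proj` over `±1` is exactly `z^ℤ`, hence
  `ker proj = ⟨z²⟩`, `center = ⟨z⟩` (an element is central iff it lies over the centre `{±1}` of `SL₂(ℝ)`,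
  `Matrix.SpecialLinearGroup.mem_center_iff`), and `z` has infinite order;
* `coverModel : CoverSL2R CoverModel.Cover` — **(12.3.1) holds for the model**; `Nonempty (CoverSL2R _)`.
What is NOT here: the topology of `S̃L₂(ℝ)` and the universal property of the covering (not part of the typed interface either);
Rmk. 12.3.2 (`S̃L₂(ℤ) ≅ B₃`, E-t35's tagged `CoverSL2R.BraidIso`) is not touched. The bridge to E-t36's `HeightDatum` (whose
numeric fields `ℓ*`, `ℓ = 2ℓ*+1` come from E-t35's `Level`, whose `Provides` is E-t35's reading of Def. 12.8.3, and whose height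
`h` stays a parameter = [Zhang 2001]) lives in the companion `Joshi/GeometricCaseCoverModelHeight.lean` (imports GeometricCase2).
FRAMING: no side is taken on [IUTchIII] Cor. 3.12, on Joshi's claims or on any author; a model exhibits satisfiability of a typed
interface, nothing more; typed ≠ proved ≠ endorsed; nothing here bears on abc. [claim: Joshi2024ATS3, status: disputed] for the
quoted sentence only — every declaration below is a definition or a proved theorem.
-/

noncomputable section

open Complex
open scoped MatrixGroups UpperHalfPlane Real

namespace Summit.ABC.IUTFork.Joshi.ATS3.Geo

namespace CoverModel

/-! ## 1. The automorphy factor `j(g, τ) = cτ + d` on `SL₂(ℝ) × ℍ` and its cocycle identity -/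

/-- The automorphy factor `j(g, τ) = cτ + d` of `g = (a b; c d) ∈ SL₂(ℝ)` at `τ ∈ ℍ`. [folklore] -/
def jAut (g : SL(2, ℝ)) (τ : ℍ) : ℂ := (g 1 0 : ℂ) * τ + (g 1 1 : ℂ)

/-- `j(g, τ) ≠ 0` (the bottom row of `g` is non-zero and `Im τ > 0`). [folklore] -/
theorem jAut_ne_zero (g : SL(2, ℝ)) (τ : ℍ) : jAut g τ ≠ 0 :=
  UpperHalfPlane.linear_ne_zero (cd := (g : Matrix (Fin 2) (Fin 2) ℝ) 1) τ
    (Matrix.SpecialLinearGroup.row_ne_zero g 1)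

/-- `g • τ = (aτ + b) / j(g, τ)` in `ℂ`. [folklore] -/
theorem coe_smul_eq (g : SL(2, ℝ)) (τ : ℍ) :
    ((g • τ : ℍ) : ℂ) = ((g 0 0 : ℂ) * τ + (g 0 1 : ℂ)) / jAut g τ := by
  rw [UpperHalfPlane.coe_specialLinearGroup_apply]; rfl

/-- The cocycle identity `j(gh, τ) = j(g, h•τ) · j(h, τ)`. [folklore] -/
theorem jAut_mul (g h : SL(2, ℝ)) (τ : ℍ) : jAut (g * h) τ = jAut g (h • τ) * jAut h τ := by
  have hne := jAut_ne_zero h τ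
  unfold jAut at hne ⊢
  rw [coe_smul_eq]
  unfold jAut
  simp only [Matrix.SpecialLinearGroup.coe_mul, Matrix.mul_apply, Fin.sum_univ_two, Complex.ofReal_add,
    Complex.ofReal_mul]
  field_simp
  ring

/-- `j(1, τ) = 1`. [folklore] -/
theorem jAut_one (τ : ℍ) : jAut 1 τ = 1 := by
  simp [jAut]

/-- `j(−1, τ) = −1`. [folklore] -/
theorem jAut_neg_one (τ : ℍ) : jAut (-1) τ = -1 := by
  simp [jAut, Matrix.SpecialLinearGroup.coe_neg]

/-- `j(g⁻¹, τ) = j(g, g⁻¹•τ)⁻¹` (cocycle at `g · g⁻¹ = 1`). [folklore] -/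
theorem jAut_inv (g : SL(2, ℝ)) (τ : ℍ) : jAut g⁻¹ τ = (jAut g (g⁻¹ • τ))⁻¹ := by
  have h := jAut_mul g g⁻¹ τ
  rw [mul_inv_cancel, jAut_one] at h
  exact eq_inv_of_mul_eq_one_right h.symm

/-- `(−g) • τ = g • τ`: `−1 ∈ SL₂(ℝ)` acts trivially on `ℍ`. [folklore] -/
theorem neg_smul_eq (g : SL(2, ℝ)) (τ : ℍ) : (-g) • τ = g • τ := by
  ext1
  rw [coe_smul_eq, coe_smul_eq]
  unfold jAut
  have e : ∀ x y : ℝ, ((-x : ℝ) : ℂ) * (τ : ℂ) + ((-y : ℝ) : ℂ) = -((x : ℂ) * τ + (y : ℂ)) := by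
    intro x y; push_cast; ring
  simp only [Matrix.SpecialLinearGroup.coe_neg, Matrix.neg_apply, e, neg_div_neg_eq]

/-- `τ ↦ g • τ` is continuous (Mathlib: the `GL₂(ℝ)`-action is by homeomorphisms; `SL₂(ℝ)` acts through it). [folklore] -/
theorem continuous_smul_sl (g : SL(2, ℝ)) : Continuous fun τ : ℍ => g • τ :=
  continuous_const_smul (Matrix.SpecialLinearGroup.mapGL ℝ g : GL (Fin 2) ℝ)

/-! ## 2. The translations `T_{g,φ}` of `ℍ × ℂ` -/

/-- `T_{g,φ} : (τ, w) ↦ (g•τ, w + φ τ)`, a permutation of `ℍ × ℂ` with inverse `(τ, w) ↦ (g⁻¹•τ, w − φ(g⁻¹•τ))`. [folklore] -/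
def liftPerm (g : SL(2, ℝ)) (φ : ℍ → ℂ) : Equiv.Perm (ℍ × ℂ) where
  toFun p := (g • p.1, p.2 + φ p.1)
  invFun p := (g⁻¹ • p.1, p.2 - φ (g⁻¹ • p.1))
  left_inv p := by simp
  right_inv p := by simp

/-- `T_{g,φ}(τ, w) = (g•τ, w + φ τ)`. -/
@[simp] theorem liftPerm_apply (g : SL(2, ℝ)) (φ : ℍ → ℂ) (p : ℍ × ℂ) :
    liftPerm g φ p = (g • p.1, p.2 + φ p.1) := rfl

/-- Composition law: `T_{g,φ} ∘ T_{h,ψ} = T_{gh, φ∘(h•·) + ψ}`. [folklore] -/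
theorem liftPerm_mul (g h : SL(2, ℝ)) (φ ψ : ℍ → ℂ) :
    liftPerm g φ * liftPerm h ψ = liftPerm (g * h) (fun τ => φ (h • τ) + ψ τ) :=
  Equiv.ext fun p => Prod.ext (by simp [mul_smul]) (by simp only [Equiv.Perm.mul_apply, liftPerm_apply]; ring)

/-- `T_{1,0} = id`. -/
theorem liftPerm_one : liftPerm 1 (fun _ => 0) = 1 :=
  Equiv.ext fun p => by simp

/-- `T_{g,φ}⁻¹ = T_{g⁻¹, −φ∘(g⁻¹•·)}`. [folklore] -/
theorem liftPerm_inv (g : SL(2, ℝ)) (φ : ℍ → ℂ) :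
    (liftPerm g φ)⁻¹ = liftPerm g⁻¹ (fun τ => -φ (g⁻¹ • τ)) :=
  Equiv.ext fun p => by simp [Equiv.Perm.inv_def, liftPerm, sub_eq_add_neg]

/-! ## 3. Continuous logarithms of the automorphy factor -/

/-- `IsLog g φ`: `φ : ℍ → ℂ` is a continuous logarithm of `j(g, ·)`, i.e. `φ` continuous and `exp (φ τ) = cτ + d`. [folklore] -/
@[folklore]
structure IsLog (g : SL(2, ℝ)) (φ : ℍ → ℂ) : Prop where
  /-- `φ` is continuous -/
  continuous : Continuous φ
  /-- `exp (φ τ) = j(g, τ)` -/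
  exp_eq : ∀ τ : ℍ, exp (φ τ) = jAut g τ

/-- Logs multiply along the cocycle: `φ∘(h•·) + ψ` is a log of `j(gh, ·)`. [folklore] -/
theorem IsLog.mul {g h : SL(2, ℝ)} {φ ψ : ℍ → ℂ} (hφ : IsLog g φ) (hψ : IsLog h ψ) :
    IsLog (g * h) (fun τ => φ (h • τ) + ψ τ) :=
  ⟨(hφ.continuous.comp (continuous_smul_sl h)).add hψ.continuous, fun τ => by rw [exp_add, hφ.exp_eq, hψ.exp_eq, jAut_mul]⟩

/-- `0` is a log of `j(1, ·) = 1`. -/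
theorem IsLog.one : IsLog 1 (fun _ => 0) :=
  ⟨continuous_const, fun τ => by rw [exp_zero, jAut_one]⟩

/-- `−φ∘(g⁻¹•·)` is a log of `j(g⁻¹, ·)`. [folklore] -/
theorem IsLog.inv {g : SL(2, ℝ)} {φ : ℍ → ℂ} (hφ : IsLog g φ) : IsLog g⁻¹ (fun τ => -φ (g⁻¹ • τ)) :=
  ⟨(hφ.continuous.comp (continuous_smul_sl g⁻¹)).neg, fun τ => by rw [exp_neg, hφ.exp_eq, jAut_inv]⟩

/-- `iπ` is a log of `j(−1, ·) = −1`. -/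
theorem IsLog.neg_one : IsLog (-1) (fun _ => π * I) :=
  ⟨continuous_const, fun τ => by rw [exp_pi_mul_I, jAut_neg_one]⟩

/-- Uniqueness of logarithms up to a constant: two continuous logs of the same `j(g, ·)` differ by a CONSTANT (`ℍ` is
contractible, hence preconnected; `exp : ℂ → ℂˣ` is a covering map — Mathlib `Complex.isCoveringMap_exp`). [folklore] -/
theorem IsLog.sub_eq_sub {g : SL(2, ℝ)} {φ ψ : ℍ → ℂ} (hφ : IsLog g φ) (hψ : IsLog g ψ) (τ τ' : ℍ) :
    φ τ - ψ τ = φ τ' - ψ τ' :=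
  Complex.isCoveringMap_exp.const_of_comp (g := fun τ => φ τ - ψ τ) (hφ.continuous.sub hψ.continuous)
    (fun a a' => Subtype.ext (by simp only [exp_sub, hφ.exp_eq, hψ.exp_eq, div_self (jAut_ne_zero g _)])) τ τ'

/-- A continuous log of `j(1, ·) = 1` is a constant `2πin`. [folklore] -/
theorem IsLog.eq_const_of_one {φ : ℍ → ℂ} (hφ : IsLog 1 φ) : ∃ n : ℤ, φ = fun _ => n * (2 * π * I) := by
  obtain ⟨n, hn⟩ := Complex.exp_eq_one_iff.mp ((hφ.exp_eq UpperHalfPlane.I).trans (jAut_one _))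
  refine ⟨n, funext fun τ => ?_⟩
  have h := hφ.sub_eq_sub IsLog.one τ UpperHalfPlane.I
  simp only [sub_zero] at h
  rw [h, hn]

/-- A continuous log of `j(−1, ·) = −1` is a constant `iπ + 2πin`. [folklore] -/
theorem IsLog.eq_const_of_neg_one {φ : ℍ → ℂ} (hφ : IsLog (-1) φ) :
    ∃ n : ℤ, φ = fun _ => π * I + n * (2 * π * I) := by
  obtain ⟨n, hn⟩ := Complex.exp_eq_exp_iff_exists_int.mp
    ((hφ.exp_eq UpperHalfPlane.I).trans ((jAut_neg_one _).trans exp_pi_mul_I.symm))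
  refine ⟨n, funext fun τ => ?_⟩
  have h := hφ.sub_eq_sub IsLog.neg_one τ UpperHalfPlane.I
  have h2 : φ τ = φ UpperHalfPlane.I := by linear_combination h
  rw [h2, hn]

/-- A continuous logarithm of `j(g, ·)` exists: `log d` if `c = 0`, else `log c + log(τ + d/c)` (principal branch; `τ + d/c`
lies in the upper half-plane, inside the slit plane). [folklore] -/
def logAut (g : SL(2, ℝ)) : ℍ → ℂ :=
  if g 1 0 = 0 then fun _ => log (g 1 1 : ℂ)
  else fun τ => log (g 1 0 : ℂ) + log ((τ : ℂ) + ((g 1 1 / g 1 0 : ℝ) : ℂ))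

/-- `logAut g` is a continuous logarithm of `j(g, ·)`. [folklore] -/
theorem isLog_logAut (g : SL(2, ℝ)) : IsLog g (logAut g) := by
  unfold logAut
  by_cases hc : g 1 0 = 0
  · rw [if_pos hc]
    have hd : g 1 1 ≠ 0 := by
      intro hd
      apply Matrix.SpecialLinearGroup.row_ne_zero g 1
      ext j; fin_cases j
      · exact hc
      · exact hd
    refine ⟨continuous_const, fun τ => ?_⟩
    rw [exp_log (by exact_mod_cast hd), jAut, hc]
    push_cast; ring
  · rw [if_neg hc]
    have hmem : ∀ τ : ℍ, (τ : ℂ) + ((g 1 1 / g 1 0 : ℝ) : ℂ) ∈ slitPlane := fun τ => by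
      rw [mem_slitPlane_iff]
      refine Or.inr ?_
      rw [add_im, ofReal_im, add_zero, UpperHalfPlane.coe_im]
      exact τ.im_ne_zero
    refine ⟨continuous_const.add ((UpperHalfPlane.continuous_coe.add continuous_const).clog hmem), fun τ => ?_⟩
    have hc' : (g 1 0 : ℂ) ≠ 0 := by exact_mod_cast hc
    rw [exp_add, exp_log hc', exp_log (slitPlane_ne_zero (hmem τ)), jAut]
    push_cast
    field_simp

/-! ## 4. The model group `Cover ⊆ SL₂(ℝ) × Perm(ℍ × ℂ)` -/

/-- **The model of `S̃L₂(ℝ)`**: pairs `(g, T_{g,φ})` with `φ` a continuous log of `j(g, ·)`; a SUBGROUP of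
`SL₂(ℝ) × Perm(ℍ × ℂ)` (closed under the product by the cocycle identity, under inverses by `jAut_inv`). [folklore] -/
def cover : Subgroup (SL(2, ℝ) × Equiv.Perm (ℍ × ℂ)) where
  carrier := {x | ∃ φ : ℍ → ℂ, IsLog x.1 φ ∧ x.2 = liftPerm x.1 φ}
  mul_mem' := by
    rintro ⟨g, P⟩ ⟨h, Q⟩ ⟨φ, hφ, hP⟩ ⟨ψ, hψ, hQ⟩
    simp only at hP hQ
    subst hP hQ
    exact ⟨_, hφ.mul hψ, liftPerm_mul g h φ ψ⟩
  one_mem' := ⟨fun _ => 0, IsLog.one, liftPerm_one.symm⟩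
  inv_mem' := by
    rintro ⟨g, P⟩ ⟨φ, hφ, hP⟩
    simp only at hP
    subst hP
    exact ⟨_, hφ.inv, liftPerm_inv g φ⟩

/-- The carrier type of the model (`Y_∞` of Def. 12.5.1 for this model). -/
abbrev Cover : Type := ↥cover

/-- The element of the model with data `(g, φ)`. -/
def mkElt (g : SL(2, ℝ)) (φ : ℍ → ℂ) (h : IsLog g φ) : Cover := ⟨(g, liftPerm g φ), φ, h, rfl⟩

/-- **The covering projection** `S̃L₂(ℝ) → SL₂(ℝ)` of (12.3.1) for the model: `(g, T) ↦ g`. -/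
def proj : Cover →* SL(2, ℝ) := (MonoidHom.fst _ _).comp cover.subtype

/-- `proj (g, T) = g`. -/
@[simp] theorem proj_apply (x : Cover) : proj x = x.1.1 := rfl

/-- **(12.3.1), exactness on the right**: `proj` is surjective (every automorphy factor has a continuous log on `ℍ`). [folklore] -/
theorem proj_surjective : Function.Surjective proj := fun g => ⟨mkElt g (logAut g) (isLog_logAut g), rfl⟩

/-- **The element `z`** of (12.3.1) for the model: `(−1, T_{−1, iπ})` (the lift of `−1` by the logarithm `iπ`). [folklore] -/
def z : Cover := mkElt (-1) (fun _ => π * I) IsLog.neg_one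

/-- `z` in the ambient group. -/
theorem coe_z : (z : SL(2, ℝ) × Equiv.Perm (ℍ × ℂ)) = (-1, liftPerm (-1) fun _ => π * I) := rfl

/-- Powers of `z` in the ambient group: `z ^ n = ((−1)^n, T_{(−1)^n, inπ})`. [folklore] -/
theorem coe_z_zpow (n : ℤ) : ((z ^ n : Cover) : SL(2, ℝ) × Equiv.Perm (ℍ × ℂ)) =
    ((-1) ^ n, liftPerm ((-1) ^ n) fun _ => n * (π * I)) := by
  rw [SubgroupClass.coe_zpow, coe_z]
  induction n using Int.induction_on with
  | zero =>
    simp only [zpow_zero, Int.cast_zero, zero_mul]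
    rw [liftPerm_one]; rfl
  | succ n ih =>
    rw [zpow_add_one, ih, Prod.mk_mul_mk, liftPerm_mul, ← zpow_add_one]
    congr 1; congr 1; funext τ; push_cast; ring
  | pred n ih =>
    rw [zpow_sub_one, ih, Prod.inv_mk, liftPerm_inv, Prod.mk_mul_mk, liftPerm_mul, ← zpow_sub_one]
    congr 1; congr 1; funext τ; push_cast; ring

/-- `(−1)^(2n) = 1` in `SL₂(ℝ)`. -/
theorem neg_one_zpow_two_mul (n : ℤ) : ((-1 : SL(2, ℝ)) ^ (2 * n)) = 1 := by
  rw [zpow_mul]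
  have : ((-1 : SL(2, ℝ)) ^ (2 : ℤ)) = 1 := by rw [zpow_two, neg_mul_neg, one_mul]
  rw [this, one_zpow]

/-- `(−1)^(2n+1) = −1` in `SL₂(ℝ)`. -/
theorem neg_one_zpow_two_mul_add_one (n : ℤ) : ((-1 : SL(2, ℝ)) ^ (2 * n + 1)) = -1 := by
  rw [zpow_add_one, neg_one_zpow_two_mul, one_mul]

/-- The fibre of `proj` over `1` is `{z^{2n}}`. [folklore] -/
theorem exists_eq_z_zpow_of_fst_eq_one {x : Cover} (hx : x.1.1 = 1) : ∃ n : ℤ, x = z ^ (2 * n) := by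
  obtain ⟨⟨g, P⟩, φ, hφ, hP⟩ := x
  simp only at hP hx
  subst hP hx
  obtain ⟨n, rfl⟩ := hφ.eq_const_of_one
  refine ⟨n, Subtype.ext ?_⟩
  rw [coe_z_zpow, neg_one_zpow_two_mul]
  simp only [Prod.mk.injEq, true_and]
  congr 1; funext τ; push_cast; ring

/-- The fibre of `proj` over `−1` is `{z^{2n+1}}`. [folklore] -/
theorem exists_eq_z_zpow_of_fst_eq_neg_one {x : Cover} (hx : x.1.1 = -1) : ∃ n : ℤ, x = z ^ (2 * n + 1) := by
  obtain ⟨⟨g, P⟩, φ, hφ, hP⟩ := x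
  simp only at hP hx
  subst hP hx
  obtain ⟨n, rfl⟩ := hφ.eq_const_of_neg_one
  refine ⟨n, Subtype.ext ?_⟩
  rw [coe_z_zpow, neg_one_zpow_two_mul_add_one]
  simp only [Prod.mk.injEq, true_and]
  congr 1; funext τ; push_cast; ring

/-- `proj z = −1`. -/
theorem proj_z : proj z = -1 := rfl

/-- **(12.3.1), exactness in the middle and on the left**: `ker proj = ⟨z²⟩`. [folklore] -/
theorem ker_proj_eq : proj.ker = Subgroup.zpowers (z ^ 2) := by
  ext x
  rw [MonoidHom.mem_ker, Subgroup.mem_zpowers_iff, proj_apply]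
  constructor
  · intro hx
    obtain ⟨n, rfl⟩ := exists_eq_z_zpow_of_fst_eq_one hx
    exact ⟨n, by rw [← zpow_natCast, ← zpow_mul]; norm_num⟩
  · rintro ⟨k, rfl⟩
    have h : ((z ^ 2) ^ k : Cover) = z ^ (2 * k) := by rw [← zpow_natCast, ← zpow_mul]; norm_num
    rw [h, ← proj_apply, map_zpow, proj_z, neg_one_zpow_two_mul]

/-- `z` is central in the model (`−1 ∈ SL₂(ℝ)` is central and acts trivially on `ℍ`; `iπ` is a constant). [folklore] -/
theorem z_mem_center : z ∈ Subgroup.center Cover := by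
  rw [Subgroup.mem_center_iff]
  rintro ⟨⟨g, P⟩, φ, hφ, hP⟩
  simp only at hP
  subst hP
  apply Subtype.ext
  simp only [Subgroup.coe_mul, coe_z, Prod.mk_mul_mk, liftPerm_mul, mul_neg_one, neg_one_mul]
  simp only [Prod.mk.injEq, true_and]
  congr 1; funext τ
  rw [show (-1 : SL(2, ℝ)) • τ = τ by rw [neg_smul_eq, one_smul], add_comm]

/-- **«`z` generates the center»**: `center = ⟨z⟩` (a central element lies over the centre `{±1}` of `SL₂(ℝ)`, and the fibres
over `±1` are the powers of `z`). [folklore] -/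
theorem center_eq : Subgroup.center Cover = Subgroup.zpowers z := by
  refine le_antisymm ?_ ((Subgroup.zpowers_le).mpr z_mem_center)
  intro x hx
  have hc : proj x ∈ Subgroup.center SL(2, ℝ) := by
    refine Subgroup.mem_center_iff.mpr fun B => ?_
    obtain ⟨y, rfl⟩ := proj_surjective B
    rw [← map_mul, ← map_mul, Subgroup.mem_center_iff.mp hx y]
  obtain ⟨r, hr, hrx⟩ := Matrix.SpecialLinearGroup.mem_center_iff.mp hc
  have hr2 : r ^ 2 = 1 := by simpa using hr
  rw [Subgroup.mem_zpowers_iff]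
  rcases sq_eq_one_iff.mp hr2 with rfl | rfl
  · have h1 : x.1.1 = 1 :=
      Subtype.ext (by rw [Matrix.SpecialLinearGroup.coe_one, ← proj_apply, ← hrx, map_one])
    obtain ⟨n, rfl⟩ := exists_eq_z_zpow_of_fst_eq_one h1
    exact ⟨2 * n, rfl⟩
  · have h1 : x.1.1 = -1 :=
      Subtype.ext (by rw [Matrix.SpecialLinearGroup.coe_neg, Matrix.SpecialLinearGroup.coe_one, ← proj_apply, ← hrx,
        map_neg, map_one])
    obtain ⟨n, rfl⟩ := exists_eq_z_zpow_of_fst_eq_neg_one h1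
    exact ⟨2 * n + 1, rfl⟩

/-- **`z` has infinite order** (`z^n` translates the `ℂ`-coordinate by `inπ`). [folklore] -/
theorem not_isOfFinOrder_z : ¬IsOfFinOrder z := by
  rw [isOfFinOrder_iff_pow_eq_one]
  rintro ⟨n, hn, h⟩
  have h2 : (((z ^ n : Cover) : SL(2, ℝ) × Equiv.Perm (ℍ × ℂ)).2 (UpperHalfPlane.I, 0)).2 =
      (((1 : Cover) : SL(2, ℝ) × Equiv.Perm (ℍ × ℂ)).2 (UpperHalfPlane.I, 0)).2 := by rw [h]
  rw [← zpow_natCast, coe_z_zpow] at h2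
  simp only [liftPerm_apply, zero_add, Subgroup.coe_one, Prod.snd_one, Equiv.Perm.coe_one, id_eq] at h2
  have hπ : (π : ℂ) * I ≠ 0 := mul_ne_zero (ofReal_ne_zero.mpr Real.pi_ne_zero) I_ne_zero
  have h3 : ((n : ℤ) : ℂ) = 0 := by simpa [hπ] using h2
  norm_cast at h3
  omega

end CoverModel

/-! ## 5. (12.3.1) for the model: T-35's interface `CoverSL2R` is inhabited -/

/-- **[J-III] (12.3.1) HOLDS for the automorphy-factor model**: the model is a `CoverSL2R` in the sense of E-t35's typing
(`Joshi/GeometricCase1.lean`, p431104) — `proj` surjective, `z` generating the centre, `ker proj = ⟨z²⟩`, `z` of infinite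
order. Hence every construction of §12.3–12.8 typed over `CoverSL2R` (log-links, `φ_∞`, Θgau-links, …) has a model. [folklore] -/
def coverModel : CoverSL2R CoverModel.Cover where
  proj := CoverModel.proj
  proj_surjective := CoverModel.proj_surjective
  z := CoverModel.z
  center_eq := CoverModel.center_eq
  ker_eq := CoverModel.ker_proj_eq
  not_isOfFinOrder_z := CoverModel.not_isOfFinOrder_z

/-- NON-VACUITY of the §12.3 interface: `CoverSL2R` has an instance (on the model carrier). -/
theorem nonempty_coverSL2R : Nonempty (CoverSL2R CoverModel.Cover) := ⟨coverModel⟩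

/-- In the model, `φ_∞ = z²` (Def. 12.5.1) is the translation `(τ, w) ↦ (τ, w + 2πi)` over `1 ∈ SL₂(ℝ)` — the deck
transformation generating `π₁(SL₂(ℝ)) ≅ ℤ` in the classical picture. [folklore] -/
theorem coe_phi_coverModel : (coverModel.phi : SL(2, ℝ) × Equiv.Perm (ℍ × ℂ)) = (1, CoverModel.liftPerm 1 fun _ => 2 * π * I) := by
  rw [CoverSL2R.phi, show coverModel.z = CoverModel.z from rfl, ← zpow_natCast, CoverModel.coe_z_zpow]
  have h1 : ((-1 : SL(2, ℝ)) ^ ((2 : ℕ) : ℤ)) = 1 := by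
    simpa using CoverModel.neg_one_zpow_two_mul 1
  rw [h1]
  simp only [Prod.mk.injEq, true_and]
  congr 1; funext τ; push_cast; ring

end Summit.ABC.IUTFork.Joshi.ATS3.Geo

end
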